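import Summits.Parity.GeneralizedHardyLittlewood.Theorems.LeeYangFibresFibrationLemmaXSum
import Mathlib.Analysis.SpecialFunctions.Pow.Real
import HarnessLib

/-!
# Fibration lemma (`DimOne → GeneralizedHardyLittlewood`), part 10a: the truncation `z(N)` and the slowly varying factors

Support file for the statement item `FibrationLemma : DimOne → GeneralizedHardyLittlewood`
(Green–Tao 2010, §1, remark after Conj. 1.2). With the truncation `z = z(N) = ⌊log_{16^d} N⌋`
(`zOf`; so `Q^d = (∏_{p ≤ z} p)^d ≤ 4^{zd} ≤ √N` and `z ≍_d log N`), every factor of the averaging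
error `avgError` of part 9 is a power of `u = 1 + log log N` — the heads are `≤ (e⁵ log z)^t`, the
tail constants `𝔅, H̄_max` are powers of `log log D_max^{t²} ≪ u` — while the small factors are `1/z`,
`1/N` and `Q^d/N ≤ 1/√N`. Hence `avgError(N, z(N)) ≪ N^{d+1} u^{2t} (1/log N + 1/√N) = o(N^{d+1})`
(parts 10b–c: `avgError_le_of_large`, `avgError_eventually_le`), and likewise for the contribution
of the bad fibres and for the bound of the singular product. This file: `zOf` and its comparison with
`log N`, two elementary limits (`exists_log_pow_le`, `exists_pow_le_exp_half`), and the bounds for the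
slowly varying factors (`headMax_le_pow`, `tailBound_le_pow`, `tailXmax_le_const`).
-/

noncomputable section

open Finset Filter Real
open scoped Topology

namespace Summit.Parity.GeneralizedHardyLittlewood.Theorems

open Literature.NumberTheory.Sieve

variable {d t : ℕ}

/-! ### The truncation `z(N)` -/

/-- `z(N) = ⌊log_{16^d} N⌋`. [folklore] -/
def zOf (d N : ℕ) : ℕ := Nat.log (16 ^ d) N

/-- `16^d > 1` for `d ≥ 1`. [folklore] -/
theorem one_lt_sixteen_pow (hd : 1 ≤ d) : 1 < 16 ^ d :=
  Nat.one_lt_pow (by omega) (by norm_num)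

/-- `(16^d)^{z(N)} ≤ N` (`N ≥ 1`). [folklore] -/
theorem pow_zOf_le {N : ℕ} (hN : 1 ≤ N) : (16 ^ d) ^ zOf d N ≤ N :=
  Nat.pow_log_le_self _ (by omega)

/-- `N < (16^d)^{z(N)+1}`. [folklore] -/
theorem lt_pow_zOf_succ (hd : 1 ≤ d) (N : ℕ) : N < (16 ^ d) ^ (zOf d N + 1) :=
  Nat.lt_pow_succ_log_self (one_lt_sixteen_pow hd) N

/-- `m ≤ z(N)` once `N ≥ (16^d)^m`. [folklore] -/
theorem le_zOf (hd : 1 ≤ d) {m N : ℕ} (h : (16 ^ d) ^ m ≤ N) : m ≤ zOf d N :=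
  Nat.le_log_of_pow_le (one_lt_sixteen_pow hd) h

/-- `z(N) · d log 16 ≤ log N` (`N ≥ 1`). [folklore] -/
theorem zOf_mul_le_log {N : ℕ} (hN : 1 ≤ N) : (zOf d N : ℝ) * ((d : ℝ) * Real.log 16) ≤ Real.log N := by
  have h := pow_zOf_le (d := d) hN
  have h' : (((16 : ℕ) ^ d) ^ zOf d N : ℝ) ≤ N := by exact_mod_cast h
  have := Real.log_le_log (by positivity) h'
  rw [Real.log_pow, Real.log_pow] at this
  push_cast at this
  linarith

/-- `log N < (z(N) + 1) · d log 16`. [folklore] -/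
theorem log_lt_zOf_succ_mul (hd : 1 ≤ d) {N : ℕ} (hN : 1 ≤ N) :
    Real.log N < ((zOf d N : ℝ) + 1) * ((d : ℝ) * Real.log 16) := by
  have h := lt_pow_zOf_succ hd N
  have hN0 : (0 : ℝ) < N := by exact_mod_cast hN
  have h' : (N : ℝ) < (((16 : ℕ) ^ d) ^ (zOf d N + 1) : ℝ) := by exact_mod_cast h
  have := Real.log_lt_log hN0 h'
  rw [Real.log_pow, Real.log_pow] at this
  push_cast at this
  linarith

/-- `1 ≤ d log 16` for `d ≥ 1`. [folklore] -/
theorem one_le_d_mul_log (hd : 1 ≤ d) : (1 : ℝ) ≤ (d : ℝ) * Real.log 16 := by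
  have h16 : (1 : ℝ) ≤ Real.log 16 := by
    rw [Real.le_log_iff_exp_le (by norm_num)]
    have := Real.exp_one_lt_three
    linarith
  have hd' : (1 : ℝ) ≤ d := by exact_mod_cast hd
  nlinarith

/-- `z(N) ≤ log N`. [folklore] -/
theorem zOf_le_log (hd : 1 ≤ d) {N : ℕ} (hN : 1 ≤ N) : (zOf d N : ℝ) ≤ Real.log N := by
  have h := zOf_mul_le_log (d := d) hN
  have h1 := one_le_d_mul_log hd
  have hz : (0 : ℝ) ≤ zOf d N := Nat.cast_nonneg _
  nlinarith

/-- `log N / (2 d log 16) ≤ z(N)` once `log N ≥ 2 d log 16`. [folklore] -/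
theorem log_div_le_zOf (hd : 1 ≤ d) {N : ℕ} (hN : 1 ≤ N) (hbig : 2 * ((d : ℝ) * Real.log 16) ≤ Real.log N) :
    Real.log N / (2 * ((d : ℝ) * Real.log 16)) ≤ zOf d N := by
  have h := log_lt_zOf_succ_mul hd hN
  have h1 := one_le_d_mul_log hd
  rw [div_le_iff₀ (by positivity)]
  nlinarith

/-- `(∏_{p ≤ z(N)} p)^d ≤ √N`. [folklore] -/
theorem primorial_zOf_pow_le_sqrt {N : ℕ} (hN : 1 ≤ N) :
    ((primorial (zOf d N) : ℕ) : ℝ) ^ d ≤ Real.sqrt N := by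
  set z := zOf d N with hz
  have h1 : primorial z ^ d ≤ 4 ^ (z * d) := by
    rw [pow_mul]; exact Nat.pow_le_pow_left (primorial_le_four_pow z) d
  have h2 : (4 ^ (z * d)) * (4 ^ (z * d)) ≤ N := by
    calc (4 ^ (z * d)) * (4 ^ (z * d)) = (16 ^ d) ^ z := by
          rw [← pow_two, ← pow_mul, show (16 : ℕ) = 4 ^ 2 by norm_num, ← pow_mul, ← pow_mul]
          ring_nf
      _ ≤ N := pow_zOf_le hN
  have h3 : (((4 : ℕ) ^ (z * d) : ℕ) : ℝ) ≤ Real.sqrt N := by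
    rw [Real.le_sqrt (by positivity) (by positivity), pow_two]
    exact_mod_cast h2
  calc ((primorial z : ℕ) : ℝ) ^ d = ((primorial z ^ d : ℕ) : ℝ) := by push_cast; ring
    _ ≤ (((4 : ℕ) ^ (z * d) : ℕ) : ℝ) := by exact_mod_cast h1
    _ ≤ Real.sqrt N := h3

/-! ### Two elementary limits -/

/-- `C (1 + log y)^k ≤ δ y` for `y` large. [folklore] -/
theorem exists_log_pow_le (k : ℕ) (C : ℝ) {δ : ℝ} (hδ : 0 < δ) :
    ∃ y₀ : ℝ, ∀ y, y₀ ≤ y → C * (1 + Real.log y) ^ k ≤ δ * y := by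
  have hC : 0 < |C| + 1 := by positivity
  set δ' : ℝ := δ / (2 ^ k * (|C| + 1)) with hδ'
  have hδ'0 : 0 < δ' := by positivity
  have hT := Real.tendsto_pow_log_div_mul_add_atTop 1 0 k one_ne_zero
  have hev : ∀ᶠ y : ℝ in atTop, Real.log y ^ k / (1 * y + 0) < δ' := hT.eventually (Iio_mem_nhds hδ'0)
  obtain ⟨y₁, hy₁⟩ := Filter.eventually_atTop.mp hev
  refine ⟨max y₁ (Real.exp 1), fun y hy => ?_⟩
  have hy1 : y₁ ≤ y := le_trans (le_max_left _ _) hy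
  have hye : Real.exp 1 ≤ y := le_trans (le_max_right _ _) hy
  have hy0 : 0 < y := lt_of_lt_of_le (Real.exp_pos 1) hye
  have hlog1 : 1 ≤ Real.log y := by rwa [Real.le_log_iff_exp_le hy0]
  have h1 := hy₁ y hy1
  simp only [one_mul, add_zero] at h1
  rw [div_lt_iff₀ hy0] at h1
  -- `(1 + log y)^k ≤ (2 log y)^k`
  have h2 : (1 + Real.log y) ^ k ≤ 2 ^ k * Real.log y ^ k := by
    rw [← mul_pow]; exact pow_le_pow_left₀ (by linarith) (by linarith) k
  calc C * (1 + Real.log y) ^ k ≤ |C| * (1 + Real.log y) ^ k :=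
        mul_le_mul_of_nonneg_right (le_abs_self C) (by positivity)
    _ ≤ |C| * (2 ^ k * Real.log y ^ k) := mul_le_mul_of_nonneg_left h2 (abs_nonneg C)
    _ ≤ |C| * (2 ^ k * (δ' * y)) := by gcongr
    _ = (|C| / (|C| + 1)) * (δ * y) := by rw [hδ']; field_simp
    _ ≤ 1 * (δ * y) := by
        refine mul_le_mul_of_nonneg_right ?_ (by positivity)
        rw [div_le_one hC]; linarith
    _ = δ * y := one_mul _

/-- `C y^k ≤ δ exp(y/2)` for `y` large. [folklore] -/
theorem exists_pow_le_exp_half (k : ℕ) (C : ℝ) {δ : ℝ} (hδ : 0 < δ) :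
    ∃ y₀ : ℝ, ∀ y, y₀ ≤ y → C * y ^ k ≤ δ * Real.exp (y / 2) := by
  have hC : 0 < |C| + 1 := by positivity
  set δ' : ℝ := δ / (2 ^ k * (|C| + 1)) with hδ'
  have hδ'0 : 0 < δ' := by positivity
  have hT := (Real.tendsto_pow_mul_exp_neg_atTop_nhds_zero k).comp
    (tendsto_id.atTop_div_const (by norm_num : (0 : ℝ) < 2))
  have hev : ∀ᶠ y : ℝ in atTop, (fun x => x ^ k * Real.exp (-x)) (y / 2) < δ' :=
    hT.eventually (Iio_mem_nhds hδ'0)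
  obtain ⟨y₁, hy₁⟩ := Filter.eventually_atTop.mp hev
  refine ⟨max y₁ 0, fun y hy => ?_⟩
  have hy1 : y₁ ≤ y := le_trans (le_max_left _ _) hy
  have hy0 : 0 ≤ y := le_trans (le_max_right _ _) hy
  have h1 := hy₁ y hy1
  simp only at h1
  have hE : 0 < Real.exp (y / 2) := Real.exp_pos _
  have h2 : (y / 2) ^ k ≤ δ' * Real.exp (y / 2) := by
    have : (y / 2) ^ k * Real.exp (-(y / 2)) * Real.exp (y / 2) ≤ δ' * Real.exp (y / 2) :=
      mul_le_mul_of_nonneg_right h1.le hE.le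
    rwa [mul_assoc, ← Real.exp_add, neg_add_cancel, Real.exp_zero, mul_one] at this
  have h3 : y ^ k = 2 ^ k * (y / 2) ^ k := by rw [← mul_pow]; congr 1; ring
  calc C * y ^ k ≤ |C| * y ^ k := mul_le_mul_of_nonneg_right (le_abs_self C) (by positivity)
    _ = |C| * (2 ^ k * (y / 2) ^ k) := by rw [h3]
    _ ≤ |C| * (2 ^ k * (δ' * Real.exp (y / 2))) := by gcongr
    _ = (|C| / (|C| + 1)) * (δ * Real.exp (y / 2)) := by rw [hδ']; field_simp
    _ ≤ 1 * (δ * Real.exp (y / 2)) := by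
        refine mul_le_mul_of_nonneg_right ?_ (by positivity)
        rw [div_le_one hC]; linarith
    _ = δ * Real.exp (y / 2) := one_mul _

/-! ### Bounds for the slowly varying factors -/

/-- `headMax t z ≤ (e⁵ (1 + log y))^t` if `2 ≤ z ≤ y`. [folklore] -/
theorem headMax_le_pow {z : ℕ} {y : ℝ} (hz : 2 ≤ z) (hzy : (z : ℝ) ≤ y) :
    headMax t z ≤ (Real.exp 5 * (1 + Real.log y)) ^ t := by
  unfold headMax
  have hz' : (2 : ℝ) ≤ z := by exact_mod_cast hz
  have hlogz : 0 ≤ Real.log z := Real.log_nonneg (by linarith)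
  have hzy' : Real.log z ≤ Real.log y := Real.log_le_log (by linarith) hzy
  exact pow_le_pow_left₀ (by positivity) (by nlinarith [Real.exp_pos 5]) t

/-- `log D_max ≤ 2 log N` once `N ≥ 2L²(d+1)`. [folklore] -/
theorem log_discMax_le {L N : ℕ} (hN : 1 ≤ N) (hbig : 2 * L * L * (d + 1) ≤ N) :
    Real.log (discMax d L N) ≤ 2 * Real.log N := by
  have hN0 : (0 : ℝ) < N := by exact_mod_cast hN
  have h1 : (discMax d L N : ℝ) ≤ (N : ℝ) * N := by
    unfold discMax
    have : ((2 * L * L * (d + 1) * N : ℕ) : ℝ) ≤ ((N * N : ℕ) : ℝ) := by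
      exact_mod_cast Nat.mul_le_mul_right N hbig
    push_cast at this ⊢
    linarith
  rcases Nat.eq_zero_or_pos (discMax d L N) with h0 | hpos
  · rw [h0]
    simp only [Nat.cast_zero, Real.log_zero]
    exact mul_nonneg (by norm_num) (Real.log_nonneg (by exact_mod_cast hN))
  · have := Real.log_le_log (by exact_mod_cast hpos) h1
    rw [Real.log_mul hN0.ne' hN0.ne'] at this
    linarith

/-- The constant of the tail bound: `C₃ = 3⁹ + 2e⁵ (1 + log(2t²))`. [folklore] -/
def tailConst (t : ℕ) : ℝ := 3 ^ 9 + 2 * Real.exp 5 * (1 + Real.log (2 * (t : ℝ) ^ 2))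

/-- `C₃ ≥ 1`. [folklore] -/
theorem one_le_tailConst (ht : 1 ≤ t) : 1 ≤ tailConst t := by
  unfold tailConst
  have ht' : (1 : ℝ) ≤ t := by exact_mod_cast ht
  have hlog : 0 ≤ Real.log (2 * (t : ℝ) ^ 2) := Real.log_nonneg (by nlinarith)
  have : 0 ≤ 2 * Real.exp 5 * (1 + Real.log (2 * (t : ℝ) ^ 2)) := by positivity
  linarith [show (1 : ℝ) ≤ 3 ^ 9 by norm_num]

/-- `totBound(D^{t²}) ≤ C₃ (1 + log y)` if `0 < log D ≤ 2y`, `1 ≤ y`. [folklore] -/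
theorem totBound_pow_le {D : ℕ} {y : ℝ} (ht : 1 ≤ t) (hD : 2 ≤ D) (hy : 1 ≤ y)
    (hlogD : Real.log D ≤ 2 * y) : totBound (D ^ (t * t)) ≤ tailConst t * (1 + Real.log y) := by
  have ht' : (1 : ℝ) ≤ t := by exact_mod_cast ht
  have hD' : (2 : ℝ) ≤ D := by exact_mod_cast hD
  have hlogD0 : 0 < Real.log D := Real.log_pos (by linarith)
  have hlogy : 0 ≤ Real.log y := Real.log_nonneg hy
  have hlog2t : 0 ≤ Real.log (2 * (t : ℝ) ^ 2) := Real.log_nonneg (by nlinarith)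
  -- `log log D^{t²} ≤ log(2t²) + log y`
  have h1 : Real.log (Real.log ((D : ℝ) ^ (t * t))) ≤ Real.log (2 * (t : ℝ) ^ 2) + Real.log y := by
    rw [Real.log_pow, ← Real.log_mul (by positivity) (by positivity)]
    refine Real.log_le_log (by positivity) ?_
    push_cast
    nlinarith
  have h2 : max 0 (Real.log (Real.log ((D : ℝ) ^ (t * t)))) ≤ Real.log (2 * (t : ℝ) ^ 2) + Real.log y :=
    max_le (by positivity) h1
  unfold totBound tailConst
  push_cast
  have h3 : Real.log (2 * (t : ℝ) ^ 2) + Real.log y ≤ (1 + Real.log (2 * (t : ℝ) ^ 2)) * (1 + Real.log y) := by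
    nlinarith
  have h39 : (3 : ℝ) ^ 9 ≤ 3 ^ 9 * (1 + Real.log y) := by nlinarith
  nlinarith [Real.exp_pos 5, mul_le_mul_of_nonneg_left (h2.trans h3) (by positivity : (0 : ℝ) ≤ 2 * Real.exp 5)]

/-- `tailBound t D ≤ (C₃ (1 + log y))^{t-1}` under the same hypotheses. [folklore] -/
theorem tailBound_le_pow {D : ℕ} {y : ℝ} (ht : 1 ≤ t) (hD : 2 ≤ D) (hy : 1 ≤ y)
    (hlogD : Real.log D ≤ 2 * y) : tailBound t D ≤ (tailConst t * (1 + Real.log y)) ^ (t - 1) :=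
  pow_le_pow_left₀ (zero_le_one.trans (one_le_totBound _)) (totBound_pow_le ht hD hy hlogD) _

/-- `X_max ≤ 32 t³ d` if `log D ≤ 2y`, `y/(2d log 16) ≤ z`, `2 ≤ z`, `0 < y`. [folklore] -/
theorem tailXmax_le_const {D z : ℕ} {y : ℝ} (hd : 1 ≤ d) (hD : 1 ≤ D) (hz : 2 ≤ z) (hy : 0 < y)
    (hlogD : Real.log D ≤ 2 * y) (hzy : y / (2 * ((d : ℝ) * Real.log 16)) ≤ z) :
    tailXmax t D z ≤ 32 * (t : ℝ) ^ 3 * d := by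
  unfold tailXmax
  have hz' : (2 : ℝ) ≤ z := by exact_mod_cast hz
  have hlog2 : Real.log 2 ≤ Real.log z := Real.log_le_log (by norm_num) hz'
  have hlog2pos : 0 < Real.log 2 := Real.log_pos (by norm_num)
  have hlogD0 : 0 ≤ Real.log D := Real.log_nonneg (by exact_mod_cast hD)
  have hc₀ := one_le_d_mul_log hd
  have h16 : Real.log 16 = 4 * Real.log 2 := by
    rw [show (16 : ℝ) = 2 ^ 4 by norm_num, Real.log_pow]; ring
  -- `z log z ≥ (y/(2 d log 16)) log 2`
  have hden : y / (2 * ((d : ℝ) * Real.log 16)) * Real.log 2 ≤ (z : ℝ) * Real.log z :=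
    mul_le_mul hzy hlog2 hlog2pos.le (by positivity)
  have hden0 : 0 < y / (2 * ((d : ℝ) * Real.log 16)) * Real.log 2 := by positivity
  rw [div_le_iff₀ (lt_of_lt_of_le hden0 hden)]
  calc 2 * (t : ℝ) ^ 3 * Real.log D ≤ 2 * (t : ℝ) ^ 3 * (2 * y) := by gcongr
    _ = 32 * (t : ℝ) ^ 3 * d * (y / (2 * ((d : ℝ) * Real.log 16)) * Real.log 2) := by
        rw [h16]; field_simp; ring
    _ ≤ 32 * (t : ℝ) ^ 3 * d * ((z : ℝ) * Real.log z) := by gcongr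

end Summit.Parity.GeneralizedHardyLittlewood.Theorems
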